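import Summits.RiemannHypothesis.RiemannHypothesis.Theses.SignCone
import Summits.RiemannHypothesis.RiemannHypothesis.Theorems.SignConeConeMagnificationCompactness
import Literature.NumberTheory.LFunctions.WeilExplicit
import Literature.NumberTheory.LFunctions.GeneralizedRH
import Mathlib.NumberTheory.LSeries.SumCoeff

/-!
# Stub `stub_chebyshev` of line `Sketch` for crux `SignCone.ConeMagnification`
(item stmt-RiemannHypothesis-16303, route route-RiemannHypothesis-SignCone)

BOUNDED DISCREPANCY ⇒ CHEBYSHEV BOUND ⇒ ABSOLUTE CONVERGENCE FOR `re s > 1`.  Let `c ≥ 0` be a weight on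
`ℕ` such that for every Weil test `g`, with `K = g ⋆ g̃ = weilConv g (weilReflect g)`, the smoothed fake
prime sum `S(x) = Σₙ c(n) n^{-1/2} (K(x + log n) + K(x − log n))` satisfies
`‖S(x) − e^{x/2} K̂(0) − e^{-x/2} K̂(1)‖ ≤ C_g` for all real `x`.  Then `Σₙ c(n) n^{-σ} < ∞` for `σ > 1`.

Proof.  Take the node-nonnegative bump `φ` of `exists_nodeNonneg_bump` (`a = 1`): `K = φ ⋆ φ̃` has
`Re K ≥ 0` everywhere and `Re K > 0` on `|t| < 2`, hence `Re K ≥ m > 0` on the compact interval `[-1, 1]`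
(extreme value theorem).  For `N ≥ 1` put `x = log N`; every term of `Re S(x)` is `≥ 0`, the sum is
finite (`K(x ± log n) = 0` once `n > e^{x+2}`), and for `N/2 < n ≤ N` one has `x − log n = log(N/n) ∈ [0, 1]`
and `√n ≤ e^{x/2} = √N`, so `(m/√N) Σ_{N/2 < n ≤ N} c(n) ≤ Re S(x) ≤ ‖S(x)‖ ≤ (C + ‖K̂(0)‖ + ‖K̂(1)‖) √N`:
the dyadic block sums are `≤ B·N`.  Strong induction (`[1, N] = [1, N/2] ∪ (N/2, N]`) gives
`Σ_{n ≤ N} c(n) ≤ 2B·N`, and `LSeriesSummable_of_sum_norm_bigO_and_nonneg` (partial sums `O(N)`,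
`c ≥ 0`) yields `LSeriesSummable c σ` for `σ > 1`.
-/

noncomputable section

-- `Summit.RiemannHypothesis.RiemannHypothesis.…` repeats a namespace component by design (D-0017 layout).
set_option linter.dupNamespace false

open scoped BigOperators ComplexConjugate Topology
open Complex MeasureTheory Set Filter

namespace Summit.RiemannHypothesis.RiemannHypothesis.Theorems.SignConeConeMagnification

open Literature.NumberTheory.LFunctions
open Summit.RiemannHypothesis.RiemannHypothesis.Theorems.SignCone

/-! ## The terms of the translated fake prime sum -/

/-- Real part of one term of the translated fake prime sum:
`Re (c(n) n^{-1/2} (K(x + log n) + K(x − log n))) = (c(n)/√n) (Re K(x + log n) + Re K(x − log n))`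
(the coefficient `c(n)/√n` is real). [folklore] -/
theorem re_fakeTerm_translate (c : ℕ → ℝ) (K : ℝ → ℂ) (x : ℝ) (n : ℕ) :
    (((c n : ℝ) : ℂ) / (Real.sqrt n : ℂ) * (K (x + Real.log n) + K (x - Real.log n))).re =
      c n / Real.sqrt n * ((K (x + Real.log n)).re + (K (x - Real.log n)).re) := by
  have hcoef : ((c n : ℝ) : ℂ) / (Real.sqrt n : ℂ) = ((c n / Real.sqrt n : ℝ) : ℂ) := by
    push_cast
    rfl
  rw [hcoef, Complex.re_ofReal_mul, Complex.add_re]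

/-- For a Weil test `g` supported in `[-1, 1]` and `x ≥ 0`, the `n`-th term of the translated fake prime
sum of `K = g ⋆ g̃` vanishes once `n > e^{x + 2}`: then `x + log n ≥ 2` and `log n − x ≥ 2`, and `K`
vanishes on `|t| ≥ 2` (`weilConv_weilReflect_eq_zero_of_le_abs`). [folklore] -/
theorem fakeTerm_translate_eq_zero {g : ℝ → ℂ} (hg : IsWeilTest g)
    (hsupp : tsupport g ⊆ Icc (-1) 1) (c : ℕ → ℝ) {x : ℝ} (hx : 0 ≤ x) {n : ℕ}
    (hn : Real.exp (x + 2) < n) :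
    ((c n : ℝ) : ℂ) / (Real.sqrt n : ℂ) *
        (weilConv g (weilReflect g) (x + Real.log n) + weilConv g (weilReflect g) (x - Real.log n)) = 0 := by
  have hpos : (0 : ℝ) < n := (Real.exp_pos _).trans hn
  have hlog : x + 2 < Real.log n := (Real.lt_log_iff_exp_lt hpos).2 hn
  have h1 : weilConv g (weilReflect g) (x + Real.log n) = 0 :=
    weilConv_weilReflect_eq_zero_of_le_abs hg hsupp
      (by rw [abs_of_nonneg (by linarith)]; linarith)
  have h2 : weilConv g (weilReflect g) (x - Real.log n) = 0 :=
    weilConv_weilReflect_eq_zero_of_le_abs hg hsupp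
      (by rw [abs_sub_comm, abs_of_nonneg (by linarith)]; linarith)
  rw [h1, h2, add_zero, mul_zero]

/-- For a Weil test `g` supported in `[-1, 1]` and `x ≥ 0`, the translated fake prime sum of `K = g ⋆ g̃`
(ANY weight) is the finite sum over `n ≤ ⌊e^{x+2}⌋`. [folklore] -/
theorem fakeSum_translate_eq_sum_range {g : ℝ → ℂ} (hg : IsWeilTest g)
    (hsupp : tsupport g ⊆ Icc (-1) 1) (c : ℕ → ℝ) {x : ℝ} (hx : 0 ≤ x) :
    (∑' n : ℕ, ((c n : ℝ) : ℂ) / (Real.sqrt n : ℂ) *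
        (weilConv g (weilReflect g) (x + Real.log n) + weilConv g (weilReflect g) (x - Real.log n))) =
      ∑ n ∈ Finset.range (⌊Real.exp (x + 2)⌋₊ + 1), ((c n : ℝ) : ℂ) / (Real.sqrt n : ℂ) *
        (weilConv g (weilReflect g) (x + Real.log n) + weilConv g (weilReflect g) (x - Real.log n)) := by
  refine tsum_eq_sum fun n hn => ?_
  rw [Finset.mem_range, not_lt] at hn
  exact fakeTerm_translate_eq_zero hg hsupp c hx
    ((Nat.lt_floor_add_one _).trans_le (by exact_mod_cast hn))

/-! ## The dyadic block bound -/

/-- **Dyadic block bound.**  Let `c ≥ 0`, let `g` be a Weil test supported in `[-1, 1]` whose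
autocorrelation `K = g ⋆ g̃` has `Re K ≥ 0` everywhere and `Re K ≥ m > 0` on `[-1, 1]`, and suppose the
discrepancy bound `‖S(x) − e^{x/2} K̂(0) − e^{-x/2} K̂(1)‖ ≤ C` for all `x`.  Then for `N ≥ 1`
(with `x = log N`, `E = e^{x/2} = √N`): `(m/E) Σ_{N/2 < n ≤ N} c(n) ≤ Re S(x) ≤ (C + ‖K̂(0)‖ + ‖K̂(1)‖) E`,
i.e. `Σ_{N/2 < n ≤ N} c(n) ≤ (C + ‖K̂(0)‖ + ‖K̂(1)‖)/m · N`. [folklore] -/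
theorem sum_Ioc_half_le_of_discrepancy {c : ℕ → ℝ} (hc : ∀ n, 0 ≤ c n) {g : ℝ → ℂ}
    (hg : IsWeilTest g) (hsupp : tsupport g ⊆ Icc (-1) 1)
    (hnn : ∀ t : ℝ, 0 ≤ (weilConv g (weilReflect g) t).re) {m : ℝ} (hm : 0 < m)
    (hmK : ∀ t ∈ Icc (-1 : ℝ) 1, m ≤ (weilConv g (weilReflect g) t).re) {C : ℝ}
    (hC : ∀ x : ℝ,
      ‖(∑' n : ℕ, ((c n : ℝ) : ℂ) / (Real.sqrt n : ℂ) *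
            (weilConv g (weilReflect g) (x + Real.log n) + weilConv g (weilReflect g) (x - Real.log n))) -
          Complex.exp (x / 2) * weilMellin (weilConv g (weilReflect g)) 0 -
          Complex.exp (-(x / 2)) * weilMellin (weilConv g (weilReflect g)) 1‖ ≤ C)
    {N : ℕ} (hN : 1 ≤ N) :
    ∑ n ∈ Finset.Ioc (N / 2) N, c n ≤
      (C + ‖weilMellin (weilConv g (weilReflect g)) 0‖ + ‖weilMellin (weilConv g (weilReflect g)) 1‖) / m *
        N := by
  set K : ℝ → ℂ := weilConv g (weilReflect g) with hK
  set x : ℝ := Real.log N with hx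
  have hN0 : (0 : ℝ) < N := by exact_mod_cast hN
  have hx0 : 0 ≤ x := Real.log_nonneg (by exact_mod_cast hN)
  set E : ℝ := Real.exp (x / 2) with hE
  have hE0 : 0 < E := Real.exp_pos _
  have hE1 : 1 ≤ E := Real.one_le_exp (by positivity)
  have hE2 : E ^ 2 = N := by
    rw [hE, sq, ← Real.exp_add, add_halves, hx, Real.exp_log hN0]
  have hC0 : 0 ≤ C := (norm_nonneg _).trans (hC 0)
  -- the translated fake sum at `x = log N` and its terms
  set T : ℕ → ℂ := fun n => ((c n : ℝ) : ℂ) / (Real.sqrt n : ℂ) *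
    (K (x + Real.log n) + K (x - Real.log n)) with hT
  -- upper bound: `‖S(x)‖ ≤ (C + ‖K̂ 0‖ + ‖K̂ 1‖) E`
  have hupper : ‖∑' n : ℕ, T n‖ ≤ (C + ‖weilMellin K 0‖ + ‖weilMellin K 1‖) * E := by
    have hsplit : (∑' n : ℕ, T n) =
        ((∑' n : ℕ, T n) - Complex.exp (x / 2) * weilMellin K 0 - Complex.exp (-(x / 2)) * weilMellin K 1) +
          Complex.exp (x / 2) * weilMellin K 0 + Complex.exp (-(x / 2)) * weilMellin K 1 := by ring
    have hA : ‖Complex.exp (x / 2) * weilMellin K 0‖ = E * ‖weilMellin K 0‖ := by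
      rw [norm_mul, Complex.norm_exp]
      congr 2
      simp
    have hB : ‖Complex.exp (-(x / 2)) * weilMellin K 1‖ ≤ ‖weilMellin K 1‖ := by
      rw [norm_mul, Complex.norm_exp]
      have hre : (-((x : ℂ) / 2)).re = -(x / 2) := by simp
      rw [hre]
      have : Real.exp (-(x / 2)) ≤ 1 := Real.exp_le_one_iff.2 (by linarith)
      exact (mul_le_of_le_one_left (norm_nonneg _) this)
    calc ‖∑' n : ℕ, T n‖
        ≤ ‖(∑' n : ℕ, T n) - Complex.exp (x / 2) * weilMellin K 0 - Complex.exp (-(x / 2)) * weilMellin K 1‖ +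
            ‖Complex.exp (x / 2) * weilMellin K 0‖ + ‖Complex.exp (-(x / 2)) * weilMellin K 1‖ := by
          nth_rw 1 [hsplit]
          exact norm_add₃_le
      _ ≤ C + E * ‖weilMellin K 0‖ + ‖weilMellin K 1‖ := by
          rw [hA]
          exact add_le_add (add_le_add (hC x) le_rfl) hB
      _ ≤ (C + ‖weilMellin K 0‖ + ‖weilMellin K 1‖) * E := by
          have h0 : 0 ≤ ‖weilMellin K 0‖ := norm_nonneg _
          have h1 : 0 ≤ ‖weilMellin K 1‖ := norm_nonneg _
          nlinarith
  -- the sum is finite and its terms have nonnegative real part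
  have hfin : (∑' n : ℕ, T n) = ∑ n ∈ Finset.range (⌊Real.exp (x + 2)⌋₊ + 1), T n :=
    fakeSum_translate_eq_sum_range hg hsupp c hx0
  have hre : ∀ n : ℕ, (T n).re =
      c n / Real.sqrt n * ((K (x + Real.log n)).re + (K (x - Real.log n)).re) := fun n =>
    re_fakeTerm_translate c K x n
  have hre0 : ∀ n : ℕ, 0 ≤ (T n).re := fun n => by
    rw [hre]
    exact mul_nonneg (div_nonneg (hc n) (Real.sqrt_nonneg _)) (add_nonneg (hnn _) (hnn _))
  -- the block `(N/2, N]` lies inside the finite range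
  have hsub : Finset.Ioc (N / 2) N ⊆ Finset.range (⌊Real.exp (x + 2)⌋₊ + 1) := by
    intro n hn
    rw [Finset.mem_Ioc] at hn
    rw [Finset.mem_range, Nat.lt_add_one_iff]
    refine Nat.le_floor ?_
    calc ((n : ℕ) : ℝ) ≤ N := by exact_mod_cast hn.2
      _ = Real.exp x := (Real.exp_log hN0).symm
      _ ≤ Real.exp (x + 2) := Real.exp_le_exp.2 (by linarith)
  -- termwise lower bound on the block
  have hterm : ∀ n ∈ Finset.Ioc (N / 2) N, c n * (m / E) ≤ (T n).re := by
    intro n hn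
    rw [Finset.mem_Ioc] at hn
    have hn1 : 1 ≤ n := by omega
    have hn0 : (0 : ℝ) < n := by exact_mod_cast hn1
    have hnN : (n : ℝ) ≤ N := by exact_mod_cast hn.2
    have h2n : (N : ℝ) < 2 * n := by
      have : N < 2 * n := by omega
      exact_mod_cast this
    -- `x - log n = log (N / n) ∈ [0, 1]`
    have hdiff : x - Real.log n = Real.log (N / n) := by
      rw [hx, Real.log_div hN0.ne' hn0.ne']
    have hquot1 : 1 ≤ (N : ℝ) / n := by rwa [le_div_iff₀ hn0, one_mul]
    have hquot2 : (N : ℝ) / n < 2 := by rwa [div_lt_iff₀ hn0]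
    have hmem : x - Real.log n ∈ Icc (-1 : ℝ) 1 := by
      rw [hdiff]
      refine ⟨?_, ?_⟩
      · linarith [Real.log_nonneg hquot1]
      · linarith [Real.log_le_sub_one_of_pos (lt_of_lt_of_le one_pos hquot1)]
    have hKm : m ≤ (K (x - Real.log n)).re := hmK _ hmem
    -- `√n ≤ E`
    have hsqrt : Real.sqrt n ≤ E := by
      calc Real.sqrt n ≤ Real.sqrt N := Real.sqrt_le_sqrt hnN
        _ = E := by rw [← hE2, Real.sqrt_sq hE0.le]
    have hsqrt0 : 0 < Real.sqrt n := Real.sqrt_pos.2 hn0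
    rw [hre]
    have hsum : m ≤ (K (x + Real.log n)).re + (K (x - Real.log n)).re := by
      linarith [hnn (x + Real.log n)]
    calc c n * (m / E) ≤ c n * (m / Real.sqrt n) :=
          mul_le_mul_of_nonneg_left (div_le_div_of_nonneg_left hm.le hsqrt0 hsqrt) (hc n)
      _ ≤ c n * (((K (x + Real.log n)).re + (K (x - Real.log n)).re) / Real.sqrt n) :=
          mul_le_mul_of_nonneg_left (div_le_div_of_nonneg_right hsum hsqrt0.le) (hc n)
      _ = c n / Real.sqrt n * ((K (x + Real.log n)).re + (K (x - Real.log n)).re) := by ring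
  -- assemble
  have hchain : (∑ n ∈ Finset.Ioc (N / 2) N, c n) * (m / E) ≤
      (C + ‖weilMellin K 0‖ + ‖weilMellin K 1‖) * E := by
    calc (∑ n ∈ Finset.Ioc (N / 2) N, c n) * (m / E)
        = ∑ n ∈ Finset.Ioc (N / 2) N, c n * (m / E) := Finset.sum_mul _ _ _
      _ ≤ ∑ n ∈ Finset.Ioc (N / 2) N, (T n).re := Finset.sum_le_sum hterm
      _ ≤ ∑ n ∈ Finset.range (⌊Real.exp (x + 2)⌋₊ + 1), (T n).re :=
          Finset.sum_le_sum_of_subset_of_nonneg hsub fun n _ _ => hre0 n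
      _ = (∑' n : ℕ, T n).re := by rw [hfin, Complex.re_sum]
      _ ≤ ‖∑' n : ℕ, T n‖ := Complex.re_le_norm _
      _ ≤ (C + ‖weilMellin K 0‖ + ‖weilMellin K 1‖) * E := hupper
  have hmE : 0 < m / E := div_pos hm hE0
  rw [← le_div_iff₀ hmE] at hchain
  refine hchain.trans (le_of_eq ?_)
  rw [← hE2]
  field_simp

/-- **Dyadic induction.**  If the block sums `Σ_{N/2 < n ≤ N} c(n)` are `≤ B·N` for all `N ≥ 1`
(`B ≥ 0`), then the partial sums satisfy `Σ_{0 < n ≤ N} c(n) ≤ 2B·N` (`(0, N] = (0, N/2] ∪ (N/2, N]`,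
strong induction on `N`). [folklore] -/
theorem sum_Ioc_zero_le_of_half {c : ℕ → ℝ} {B : ℝ} (hB : 0 ≤ B)
    (h : ∀ N : ℕ, 1 ≤ N → ∑ n ∈ Finset.Ioc (N / 2) N, c n ≤ B * N) (N : ℕ) :
    ∑ n ∈ Finset.Ioc 0 N, c n ≤ 2 * B * N := by
  induction N using Nat.strong_induction_on with
  | _ N ih =>
    rcases Nat.eq_zero_or_pos N with rfl | hN
    · simp
    · rw [← Finset.sum_Ioc_consecutive c (Nat.zero_le (N / 2)) (Nat.div_le_self N 2)]
      have h1 := ih (N / 2) (Nat.div_lt_self hN one_lt_two)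
      have h2 := h N hN
      have h3 : ((N / 2 : ℕ) : ℝ) ≤ (N : ℝ) / 2 := Nat.cast_div_le
      nlinarith

/-! ## The stub -/

/-- **Stub 2 — `chebyshev` (bounded discrepancy ⇒ Chebyshev bound ⇒ `Σ c(n) n^{-σ} < ∞` for `σ > 1`).**
From the discrepancy bound for the node-positive bump `φ` of `exists_nodeNonneg_bump` (its
autocorrelation `K = φ ⋆ φ̃` has `Re K ≥ 0` everywhere and `Re K ≥ m > 0` on `[-1, 1]`): since `c ≥ 0`,
`(m/√N) Σ_{N/2 < n ≤ N} c(n) ≤ Re Σₙ c(n) n^{-1/2}(K(x + log n) + K(x − log n)) ≤ (C + ‖K̂(0)‖ + ‖K̂(1)‖) √N`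
at `x = log N`, so the dyadic blocks are `O(N)`, the partial sums `Σ_{n ≤ N} c(n)` are `O(N)`, and
`LSeriesSummable_of_sum_norm_bigO_and_nonneg` gives absolute convergence for `re s > 1`. [folklore] -/
theorem stub_chebyshev :
    ∀ c : ℕ → ℝ, (∀ n, 0 ≤ c n) →
      (∀ g : ℝ → ℂ, IsWeilTest g → ∃ C : ℝ, ∀ x : ℝ,
        ‖(∑' n : ℕ, ((c n : ℝ) : ℂ) / (Real.sqrt n : ℂ) *
            (weilConv g (weilReflect g) (x + Real.log n) + weilConv g (weilReflect g) (x - Real.log n))) -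
          Complex.exp (x / 2) * weilMellin (weilConv g (weilReflect g)) 0 -
          Complex.exp (-(x / 2)) * weilMellin (weilConv g (weilReflect g)) 1‖ ≤ C) →
      ∀ σ : ℝ, 1 < σ → LSeriesSummable (fun n => ((c n : ℝ) : ℂ)) σ := by
  intro c hc hdisc σ hσ
  obtain ⟨φ, hφ, hsupp, hnn, hpos⟩ := exists_nodeNonneg_bump (a := (1 : ℝ)) one_pos
  -- `Re K ≥ m > 0` on `[-1, 1]`
  have hKc : Continuous (weilConv φ (weilReflect φ)) := (hφ.weilConv hφ.weilReflect).1.continuous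
  obtain ⟨t₀, ht₀, hmin⟩ := (isCompact_Icc : IsCompact (Icc (-1 : ℝ) 1)).exists_isMinOn
    (nonempty_Icc.2 (by norm_num)) (Complex.continuous_re.comp hKc).continuousOn
  set m : ℝ := (weilConv φ (weilReflect φ) t₀).re with hm_def
  have hm : 0 < m := hpos t₀ (by rw [mul_one]; exact (abs_le.2 ⟨ht₀.1, ht₀.2⟩).trans_lt one_lt_two)
  have hmK : ∀ t ∈ Icc (-1 : ℝ) 1, m ≤ (weilConv φ (weilReflect φ) t).re := fun t ht =>
    (isMinOn_iff.1 hmin) t ht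
  obtain ⟨C, hC⟩ := hdisc φ hφ
  have hC0 : 0 ≤ C := (norm_nonneg _).trans (hC 0)
  set B : ℝ := (C + ‖weilMellin (weilConv φ (weilReflect φ)) 0‖ +
    ‖weilMellin (weilConv φ (weilReflect φ)) 1‖) / m with hB_def
  have hB : 0 ≤ B := by positivity
  have hblock : ∀ N : ℕ, 1 ≤ N → ∑ n ∈ Finset.Ioc (N / 2) N, c n ≤ B * N := fun N hN =>
    sum_Ioc_half_le_of_discrepancy hc hφ hsupp hnn hm hmK hC hN
  have hall : ∀ N : ℕ, ∑ n ∈ Finset.Ioc 0 N, c n ≤ 2 * B * N := sum_Ioc_zero_le_of_half hB hblock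
  have hO : (fun n ↦ ∑ k ∈ Finset.Icc 1 n, c k) =O[atTop] fun n ↦ (n : ℝ) ^ (1 : ℝ) := by
    refine Asymptotics.IsBigO.of_bound (2 * B) (Eventually.of_forall fun n => ?_)
    have hIcc : Finset.Icc 1 n = Finset.Ioc 0 n := Finset.Icc_add_one_left_eq_Ioc 0 n
    rw [Real.norm_of_nonneg (Finset.sum_nonneg fun k _ => hc k), Real.rpow_one, Real.norm_natCast, hIcc]
    exact hall n
  exact LSeriesSummable_of_sum_norm_bigO_and_nonneg hO hc zero_le_one (by simpa using hσ)

end Summit.RiemannHypothesis.RiemannHypothesis.Theorems.SignConeConeMagnification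

end
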